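import Literature.Topology.FourManifolds.FlowerHandlebody
import Mathlib.Analysis.SpecialFunctions.Trigonometric.Inverse
import Mathlib.Analysis.SpecialFunctions.Complex.Arg
import HarnessLib

/-!
# The flower domain in polar coordinates: the disc with `g` holes `{q_g ≤ c_g}`, explicitly

Topic `Literature/Topology/FourManifolds`; fact seat
`provefact-Literature.Topology.FourManifolds.exists-cbed50d78a` (named fact (g′)
`Literature.Topology.FourManifolds.exists_marking_centralSurface_of_gkTrisection`), sequel of
`FlowerHandlebody.lean`.  There the explicit genus-`g` handlebody `V_g = {q_g(x, y) + z² ≤ c_g}`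
(`g ≥ 2`) was constructed, with boundary the flower surface `{q_g + z² = c_g}`, the double of the
planar flower domain `D = {q_g ≤ c_g}` along its boundary.  The computation of `π₁` of that surface
(the marking by the surface group `S_g`, Hatcher §1.2 p. 51) proceeds sector by sector in polar
coordinates; this file provides the **explicit polar description of the flower domain**.
Everything is proved; no named facts.

With `V(r) = g⁻¹ r^g E(r²)` (`FlowerModel.V`) the flower reads, in polar coordinates
(`FlowerModel.pol r θ = toC⁻¹(r e^{iθ})`),

  `q_g(pol r θ) = r² + V(r) cos(gθ)`                                  (`FlowerModel.flower_pol`),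

so between the peak profile `prof r = r² + V` (`θ = 2πj/g`) and the valley profile
`vprof r = r² - V` (`θ = (2j+1)π/g`).  We prove:

* §3 `vprof` is strictly increasing; the **outer radius** `ρ₄ ∈ (7^{1/20g}, 6)` with
  `vprof ρ₄ = c` (`FlowerModel.rho4`); `D ⊆ {r ≤ ρ₄}` (`norm_le_rho4_of_flower_le`).
* §4 with `κ(r) = (c - r²)/V(r)` and the **floor** `θ_lo(r) = g⁻¹ arccos(min(1, κ(r)))`
  (`FlowerModel.thlo`, continuous on `[0, ∞)`, `= 0` near `0`, `≤ π/(2g)` where `r² ≤ c`,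
  `= π/g` at `ρ₄`): the **floor criterion** `q(pol r θ) ≤ c ↔ θ_lo(r) ≤ θ` and the **seam
  criterion** `q(pol r θ) = c ↔ c ≤ prof r ∧ θ = θ_lo(r)` for `0 < r ≤ ρ₄`, `0 ≤ θ ≤ π/g`
  (`flower_pol_le_level_iff`, `flower_pol_eq_level_iff`); by the symmetries
  (`flower_pol_neg`, `flower_pol_add`, `rot_pol`) this describes all of `D`: the circle of radius
  `r` meets `D` in the `g` arcs `θ_lo(r) ≤ |θ - 2πj/g| ≤ π/g`.
* §5 the **half-wedge** `W₊ = D ∩ {0 ≤ arg ≤ π/g}` (`FlowerModel.halfWedge`) is the image under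
  `pol` of the compact parameter region `{0 ≤ r ≤ ρ₄, θ_lo(r) ≤ θ ≤ π/g}`
  (`halfWedge_eq_image`, `isCompact_halfWedge`) — a region under the constant ceiling `θ = π/g`
  over the continuous floor `θ_lo`.
* §6 the peak ray: `prof` increases on `[0, r_a]`, decreases on `[r_a, r_b]`, increases on
  `[r_b, ∞)`; the **pinch radii** `ρ₁ ∈ (4/5, r_a)` and `ρ₃ ∈ (r_b, 6)` with `prof = c`
  (`FlowerModel.rho1`, `FlowerModel.rho3`), `ρ₃ < ρ₄`, and
  `prof r ≤ c ↔ r ≤ ρ₁ ∨ 7^{1/20g} ≤ r ≤ ρ₃` (`prof_le_level_iff`): along the peak ray the domain is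
  `[0, ρ₁] ∪ [7^{1/20g}, ρ₃]`, the hole (lens) occupying `(ρ₁, 7^{1/20g})` and the indentation of
  the outer boundary reaching down to `ρ₃`; accordingly `θ_lo = 0` exactly on
  `[0, ρ₁] ∪ [7^{1/20g}, ρ₃]` and `θ_lo > 0` on the lens and petal ranges.

So the floor of the half-wedge consists of the axis segment `[0, ρ₁]`, the upper branch of the
lens `(ρ₁, 7^{1/20g})` (seam), the segment `m = [7^{1/20g}, ρ₃]` of the peak ray (interior) and
the outer boundary arc over `(ρ₃, ρ₄]` (seam) — the data from which the sequel deformation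
retracts each sector of the flower surface onto a wedge of two circles.

## References

* D. Gay, R. Kirby, *Trisecting 4-manifolds*, Geom. Topol. 20 (2016), Def. 1 and Remark 2
  (p. 3098). [GayKirby2016]
* A. Hatcher, *Algebraic Topology* (2002), §1.2, p. 51. [HatcherAT2002]
* A. Juhász, *Differential and Low-Dimensional Topology* (2023), §3.5, pp. 96–97. [Juhasz2023]
-/

open scoped Manifold ContDiff Topology InnerProductSpace Real
open Set Function Filter Metric Module Complex

noncomputable section

namespace Literature.Topology.FourManifolds

/-- Local notation: `𝔼 n` is the model Euclidean space `EuclideanSpace ℝ (Fin n)`. -/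
local notation "𝔼 " n:arg => EuclideanSpace ℝ (Fin n)

namespace FlowerModel

variable {g : ℕ}

/-! ### §1 Polar points -/

/-- The point with polar coordinates `(r, θ)`: `pol r θ = toC⁻¹ (r e^{iθ})`. [folklore] -/
def pol (r θ : ℝ) : 𝔼 2 := toC.symm (r * Complex.exp (θ * I))

/-- `toC (pol r θ) = r e^{iθ}`. [folklore] -/
@[simp] theorem toC_pol (r θ : ℝ) : toC (pol r θ) = r * Complex.exp (θ * I) := by simp [pol]

/-- `‖pol r θ‖ = |r|`. [folklore] -/
@[simp] theorem norm_pol (r θ : ℝ) : ‖pol r θ‖ = |r| := by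
  rw [← norm_toC, toC_pol, norm_mul, Complex.norm_real, Real.norm_eq_abs, Complex.norm_exp_ofReal_mul_I,
    mul_one]

/-- `pol 0 θ = 0`. [folklore] -/
@[simp] theorem pol_zero_left (θ : ℝ) : pol 0 θ = 0 := by
  apply toC.injective; rw [toC_pol]; simp

/-- `(0, 0) = 0`. [folklore] -/
@[simp] theorem ax_zero : ax 0 = 0 := by
  apply toC.injective; rw [toC_ax]; simp

/-- `pol r 0 = (r, 0)`. [folklore] -/
@[simp] theorem pol_zero_right (r : ℝ) : pol r 0 = ax r := by
  apply toC.injective; rw [toC_pol, toC_ax]; simp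

/-- `pol` is continuous in `(r, θ)`. [folklore] -/
theorem continuous_pol : Continuous (fun x : ℝ × ℝ => pol x.1 x.2) := by
  unfold pol
  apply toC.symm.continuous.comp
  fun_prop

/-- `pol` is `2π`-periodic in the angle. [folklore] -/
theorem pol_add_two_pi (r θ : ℝ) : pol r (θ + 2 * π) = pol r θ := by
  apply toC.injective
  rw [toC_pol, toC_pol]
  have : ((θ + 2 * π : ℝ) : ℂ) * I = θ * I + 2 * π * I := by push_cast; ring
  rw [this, Complex.exp_add, Complex.exp_two_pi_mul_I, mul_one]

/-- Every point of the plane has polar coordinates `(‖p‖, arg)`. [folklore] -/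
theorem exists_eq_pol (p : 𝔼 2) : ∃ θ ∈ Ioc (-π) π, p = pol ‖p‖ θ := by
  refine ⟨Complex.arg (toC p), ⟨Complex.neg_pi_lt_arg _, Complex.arg_le_pi _⟩, ?_⟩
  apply toC.injective
  rw [toC_pol, ← norm_toC]
  exact (Complex.norm_mul_exp_arg_mul_I (toC p)).symm

/-- The angular harmonic in polar coordinates: `P(pol r θ) = r^g cos(gθ)`. [folklore] -/
theorem harm_pol (r θ : ℝ) : harm g (pol r θ) = r ^ g * Real.cos (g * θ) := by
  rw [harm, toC_pol, mul_pow, ← Complex.exp_nat_mul, ← Complex.ofReal_pow]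
  have : (g : ℂ) * (θ * I) = ((g * θ : ℝ) : ℂ) * I := by push_cast; ring
  rw [this, Complex.re_ofReal_mul, Complex.exp_ofReal_mul_I_re]

variable (g) in
/-- The radial amplitude `V(r) = g⁻¹ r^g E(r²)` of the angular term. [folklore] -/
def V (r : ℝ) : ℝ := (g : ℝ)⁻¹ * r ^ g * damp g (r ^ 2)

/-- **The flower in polar coordinates: `q(pol r θ) = r² + V(r) cos(gθ)`.** [folklore] -/
theorem flower_pol (r θ : ℝ) : flower g (pol r θ) = r ^ 2 + V g r * Real.cos (g * θ) := by
  rw [flower, norm_pol, sq_abs, harm_pol, V]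
  ring

/-- The peak-ray profile is `r² + V`. [folklore] -/
theorem prof_eq (r : ℝ) : prof g r = r ^ 2 + V g r := by rw [prof, V]

/-- `V > 0` for `r > 0`. [folklore] -/
theorem V_pos (hg : 1 ≤ g) {r : ℝ} (hr : 0 < r) : 0 < V g r := by
  have : (0 : ℝ) < g := by exact_mod_cast (show 0 < g by omega)
  unfold V
  exact mul_pos (mul_pos (by positivity) (pow_pos hr _)) (damp_pos _)

/-- `V ≥ 0` for `r ≥ 0`. [folklore] -/
theorem V_nonneg {r : ℝ} (hr : 0 ≤ r) : 0 ≤ V g r := by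
  unfold V
  exact mul_nonneg (mul_nonneg (by positivity) (pow_nonneg hr _)) (damp_pos _).le

/-- `V(0) = 0` (`g ≥ 1`). [folklore] -/
theorem V_zero (hg : 1 ≤ g) : V g 0 = 0 := by
  simp [V, zero_pow (show g ≠ 0 by omega)]

/-- The damped power is bounded: `r^g E(r²) ≤ 20` (`r ≥ 0`, `g ≥ 1`). [folklore] -/
theorem pow_mul_damp_le (hg : 1 ≤ g) {r : ℝ} (hr0 : 0 ≤ r) : r ^ g * damp g (r ^ 2) ≤ 20 := by
  rw [damp_sq]
  rcases le_or_gt r 1 with h1 | h1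
  · calc r ^ g * Real.exp (-(r ^ (20 * g) / 20)) ≤ 1 * 1 := by
          gcongr
          · exact pow_le_one₀ hr0 h1
          · rw [Real.exp_le_one_iff, neg_nonpos]; positivity
      _ ≤ 20 := by norm_num
  · have hu : r ^ g ≤ r ^ (20 * g) := pow_le_pow_right₀ h1.le (by omega)
    have hexp : r ^ (20 * g) / 20 + 1 ≤ Real.exp (r ^ (20 * g) / 20) := Real.add_one_le_exp _
    have hpos := Real.exp_pos (r ^ (20 * g) / 20)
    rw [Real.exp_neg, mul_inv_le_iff₀ hpos]
    nlinarith

/-- `V ≤ 20` on `r ≥ 0` (`g ≥ 1`). [folklore] -/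
theorem V_le (hg : 1 ≤ g) {r : ℝ} (hr0 : 0 ≤ r) : V g r ≤ 20 := by
  have hg' : (1 : ℝ) ≤ g := by exact_mod_cast hg
  have h1 : (g : ℝ)⁻¹ ≤ 1 := inv_le_one_of_one_le₀ hg'
  calc V g r = (g : ℝ)⁻¹ * (r ^ g * damp g (r ^ 2)) := by rw [V]; ring
    _ ≤ 1 * 20 := by
        gcongr
        exact mul_nonneg (pow_nonneg hr0 _) (damp_pos _).le
        exact pow_mul_damp_le hg hr0
    _ = 20 := one_mul _

/-- `V ≤ r²/2` for `0 ≤ r ≤ 1` (`g ≥ 2`). [folklore] -/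
theorem V_le_half_sq (hg : 2 ≤ g) {r : ℝ} (hr0 : 0 ≤ r) (hr1 : r ≤ 1) : V g r ≤ r ^ 2 / 2 := by
  have hg' : (2 : ℝ) ≤ g := by exact_mod_cast hg
  have h1 : (g : ℝ)⁻¹ ≤ 1 / 2 := by
    rw [inv_eq_one_div]; exact one_div_le_one_div_of_le (by norm_num) hg'
  have h2 : r ^ g ≤ r ^ 2 := pow_le_pow_of_le_one hr0 hr1 hg
  have h3 := damp_le_one (g := g) (sq_nonneg r)
  calc V g r = (g : ℝ)⁻¹ * (r ^ g * damp g (r ^ 2)) := by rw [V]; ring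
    _ ≤ (1 / 2) * (r ^ 2 * 1) := by
        gcongr
        exact mul_nonneg (pow_nonneg hr0 _) (damp_pos _).le
        exact (damp_pos _).le
    _ = r ^ 2 / 2 := by ring

/-! ### §2 Symmetries in polar coordinates -/

/-- Rotation by `ζ_j` adds `2πj/g` to the angle. [folklore] -/
theorem rot_pol (hg : 1 ≤ g) (j : ℕ) (r θ : ℝ) : rot (ζC g j) (pol r θ) = pol r (θ + 2 * π * j / g) := by
  have hg' : (g : ℂ) ≠ 0 := by exact_mod_cast (show g ≠ 0 by omega)
  apply toC.injective
  rw [toC_rot, toC_pol, toC_pol, coe_ζC, ← Complex.exp_nat_mul, mul_left_comm, ← Complex.exp_add]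
  congr 2
  push_cast
  field_simp
  ring

/-- The flower is even in the angle. [folklore] -/
theorem flower_pol_neg (r θ : ℝ) : flower g (pol r (-θ)) = flower g (pol r θ) := by
  rw [flower_pol, flower_pol, mul_neg, Real.cos_neg]

/-- The flower is `2π/g`-periodic in the angle (`g ≥ 1`). [folklore] -/
theorem flower_pol_add (hg : 1 ≤ g) (r θ : ℝ) : flower g (pol r (θ + 2 * π / g)) = flower g (pol r θ) := by
  have hg' : (g : ℝ) ≠ 0 := by exact_mod_cast (show g ≠ 0 by omega)
  rw [flower_pol, flower_pol, mul_add, mul_div_cancel₀ _ hg', Real.cos_add_two_pi]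

/-! ### §3 The valley profile and the outer radius `ρ₄` -/

variable (g) in
/-- The valley-ray profile `r² - V(r) = q(pol r (π/g))`. [folklore] -/
def vprof (r : ℝ) : ℝ := r ^ 2 - V g r

/-- The flower on a valley ray. [folklore] -/
theorem flower_pol_valley (hg : 1 ≤ g) (r : ℝ) : flower g (pol r (π / g)) = vprof g r := by
  have hg' : (g : ℝ) ≠ 0 := by exact_mod_cast (show g ≠ 0 by omega)
  rw [flower_pol, vprof, mul_div_cancel₀ _ hg', Real.cos_pi]; ring

/-- The valley profile has derivative `fvd`. [folklore] -/
theorem hasDerivAt_vprof (hg : 1 ≤ g) (r : ℝ) : HasDerivAt (vprof g) (fvd g r) r := by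
  have h1 := hasDerivAt_prof hg r
  have h2 : HasDerivAt (fun x : ℝ => x ^ 2) (2 * r) r := by simpa using hasDerivAt_pow 2 r
  have hfun : vprof g = fun x => 2 * x ^ 2 - prof g x := by
    funext x; rw [vprof, prof_eq]; ring
  rw [hfun]
  refine ((h2.const_mul 2).sub h1).congr_deriv ?_
  rw [fvd, fd]; ring

/-- The valley profile is continuous. [folklore] -/
theorem continuous_vprof (hg : 1 ≤ g) : Continuous (vprof g) :=
  continuous_iff_continuousAt.2 fun r => (hasDerivAt_vprof hg r).continuousAt

/-- **The valley profile is strictly increasing on `[0, ∞)`** (`g ≥ 2`). [folklore] -/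
theorem strictMonoOn_vprof (hg : 2 ≤ g) : StrictMonoOn (vprof g) (Ici 0) := by
  have hg1 : 1 ≤ g := by omega
  refine strictMonoOn_of_deriv_pos (convex_Ici 0) (continuous_vprof hg1).continuousOn fun x hx => ?_
  rw [interior_Ici] at hx
  rw [(hasDerivAt_vprof hg1 x).deriv]
  exact fvd_pos hg hx

/-- `vprof ≤ prof`. [folklore] -/
theorem vprof_le_prof {r : ℝ} (hr : 0 ≤ r) : vprof g r ≤ prof g r := by
  rw [vprof, prof_eq]; linarith [V_nonneg (g := g) hr]

/-- `q(pol r θ)` lies between the valley and the peak profiles (`r ≥ 0`). [folklore] -/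
theorem vprof_le_flower_pol {r : ℝ} (hr : 0 ≤ r) (θ : ℝ) : vprof g r ≤ flower g (pol r θ) := by
  rw [vprof, flower_pol]
  nlinarith [V_nonneg (g := g) hr, Real.neg_one_le_cos (g * θ)]

/-- `q(pol r θ) ≤ prof r` (`r ≥ 0`). [folklore] -/
theorem flower_pol_le_prof {r : ℝ} (hr : 0 ≤ r) (θ : ℝ) : flower g (pol r θ) ≤ prof g r := by
  rw [prof_eq, flower_pol]
  nlinarith [V_nonneg (g := g) hr, Real.cos_le_one (g * θ)]

/-- `vprof 0 = 0`. [folklore] -/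
theorem vprof_zero (hg : 1 ≤ g) : vprof g 0 = 0 := by simp [vprof, V_zero hg]

/-- A crude bound for the level: `c < 15`. [folklore] -/
theorem level_lt (hg : 2 ≤ g) : level g < 15 := by
  have hg1 : 1 ≤ g := by omega
  have h1 : 1 ≤ rt g 7 := one_le_rt (by norm_num)
  have h7 : (rt g 7) ^ (20 * g) = 7 := rt_pow hg1 (by norm_num)
  have hsq : (rt g 7) ^ 2 ≤ 7 := by
    calc (rt g 7) ^ 2 ≤ (rt g 7) ^ (20 * g) := pow_le_pow_right₀ h1 (by omega)
      _ = 7 := h7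
  rw [level, prof_eq]
  have hV := V_le hg1 (le_trans zero_le_one h1)
  have : V g (rt g 7) < 8 := by
    have hpow : (rt g 7) ^ g ≤ 7 := by
      calc (rt g 7) ^ g ≤ (rt g 7) ^ (20 * g) := pow_le_pow_right₀ h1 (by omega)
        _ = 7 := h7
    have hg' : (1 : ℝ) ≤ g := by exact_mod_cast hg1
    have hinv : (g : ℝ)⁻¹ ≤ 1 := inv_le_one_of_one_le₀ hg'
    have hd := damp_le_one (g := g) (sq_nonneg (rt g 7))
    calc V g (rt g 7) = (g : ℝ)⁻¹ * ((rt g 7) ^ g * damp g ((rt g 7) ^ 2)) := by rw [V]; ring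
      _ ≤ 1 * (7 * 1) := by
          gcongr
          · exact mul_nonneg (pow_nonneg (by linarith) _) (damp_pos _).le
          · exact (damp_pos _).le
      _ < 8 := by norm_num
  linarith

/-- `vprof 6 > c`. [folklore] -/
theorem level_lt_vprof_six (hg : 2 ≤ g) : level g < vprof g 6 := by
  have hV := V_le (g := g) (by omega) (by norm_num : (0:ℝ) ≤ 6)
  rw [vprof]
  linarith [level_lt hg]

/-- There is a radius `ρ₄ ∈ (0, 6)` with `vprof ρ₄ = c`. [folklore] -/
theorem exists_rho4 (hg : 2 ≤ g) : ∃ r, r ∈ Ioo (0 : ℝ) 6 ∧ vprof g r = level g := by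
  have hg1 : 1 ≤ g := by omega
  have h := intermediate_value_Ioo (by norm_num : (0 : ℝ) ≤ 6) (continuous_vprof hg1).continuousOn
    (f := vprof g)
  have hmem : level g ∈ Ioo (vprof g 0) (vprof g 6) := by
    rw [vprof_zero hg1]; exact ⟨level_pos hg1, level_lt_vprof_six hg⟩
  obtain ⟨r, hr, hr2⟩ := h hmem
  exact ⟨r, hr, hr2⟩

/-- **The outer radius `ρ₄`**: the flower domain reaches `r = ρ₄` exactly along the valley rays.
[folklore] -/
def rho4 (hg : 2 ≤ g) : ℝ := Classical.choose (exists_rho4 hg)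

/-- `ρ₄ ∈ (0, 6)`. [folklore] -/
theorem rho4_mem (hg : 2 ≤ g) : rho4 hg ∈ Ioo (0 : ℝ) 6 := (Classical.choose_spec (exists_rho4 hg)).1

/-- `vprof ρ₄ = c`. [folklore] -/
theorem vprof_rho4 (hg : 2 ≤ g) : vprof g (rho4 hg) = level g := (Classical.choose_spec (exists_rho4 hg)).2

/-- `ρ₄ > 0`. [folklore] -/
theorem rho4_pos (hg : 2 ≤ g) : 0 < rho4 hg := (rho4_mem hg).1

/-- **`vprof r ≤ c ↔ r ≤ ρ₄`** for `r ≥ 0`. [folklore] -/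
theorem vprof_le_level_iff (hg : 2 ≤ g) {r : ℝ} (hr : 0 ≤ r) : vprof g r ≤ level g ↔ r ≤ rho4 hg := by
  rw [← vprof_rho4 hg]
  exact (strictMonoOn_vprof hg).le_iff_le hr (rho4_pos hg).le

/-- `vprof r = c ↔ r = ρ₄` for `r ≥ 0`. [folklore] -/
theorem vprof_eq_level_iff (hg : 2 ≤ g) {r : ℝ} (hr : 0 ≤ r) : vprof g r = level g ↔ r = rho4 hg := by
  rw [← vprof_rho4 hg]
  exact ((strictMonoOn_vprof hg).injOn.eq_iff hr (rho4_pos hg).le)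

/-- **The flower domain lies in the disc of radius `ρ₄`**: `q(pol r θ) ≤ c` with `r ≥ 0` forces
`r ≤ ρ₄`. [folklore] -/
theorem le_rho4_of_flower_pol_le (hg : 2 ≤ g) {r : ℝ} (hr : 0 ≤ r) {θ : ℝ}
    (h : flower g (pol r θ) ≤ level g) : r ≤ rho4 hg :=
  (vprof_le_level_iff hg hr).1 (le_trans (vprof_le_flower_pol hr θ) h)

/-- The same for an arbitrary point of the sublevel set. [folklore] -/
theorem norm_le_rho4_of_flower_le (hg : 2 ≤ g) {p : 𝔼 2} (h : flower g p ≤ level g) : ‖p‖ ≤ rho4 hg := by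
  obtain ⟨θ, -, hp⟩ := exists_eq_pol p
  rw [hp] at h
  exact le_rho4_of_flower_pol_le hg (norm_nonneg p) h

/-- `7^{1/20g} < ρ₄`: the level radius of the peak ray lies inside. [folklore] -/
theorem rt_seven_lt_rho4 (hg : 2 ≤ g) : rt g 7 < rho4 hg := by
  have hg1 : 1 ≤ g := by omega
  have h1 : 0 ≤ rt g 7 := le_trans zero_le_one (one_le_rt (by norm_num))
  have hlt : vprof g (rt g 7) < level g := by
    rw [level, vprof, prof_eq]
    linarith [V_pos hg1 (lt_of_lt_of_le zero_lt_one (one_le_rt (g := g) (by norm_num : (1:ℝ) ≤ 7)))]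
  by_contra hle
  push Not at hle
  have := (strictMonoOn_vprof hg).le_iff_le (rho4_pos hg).le h1 |>.2 hle
  rw [vprof_rho4 hg] at this
  linarith


/-! ### §4 The floor function `θ_lo` and the polar description of the flower domain -/

variable (g) in
/-- `κ(r) = (c - r²) / V(r)`: the flower domain meets the circle of radius `r` where
`cos(gθ) ≤ κ(r)`. [folklore] -/
def kap (r : ℝ) : ℝ := (level g - r ^ 2) / V g r

variable (g) in
/-- **The floor** `θ_lo(r) = g⁻¹ arccos(min(1, κ(r)))` (and `0` near the origin, where `κ ≥ 1`): for
`0 < r ≤ ρ₄` the flower domain meets the circle of radius `r` in the `g` arcs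
`θ_lo(r) ≤ |θ - 2πj/g| ≤ π/g`. [folklore] -/
def thlo (r : ℝ) : ℝ := if r ≤ 1 / 2 then 0 else Real.arccos (min 1 (kap g r)) / g

/-- `1 ≤ c`. [folklore] -/
theorem one_le_level : 1 ≤ level g := by
  have h1 : 1 ≤ rt g 7 := one_le_rt (by norm_num)
  rw [level, prof_eq]
  nlinarith [V_nonneg (g := g) (le_trans zero_le_one h1)]

/-- Near the origin the peak profile is below the level: `prof r < 1 ≤ c` for `0 ≤ r ≤ 4/5`
(`g ≥ 2`). [folklore] -/
theorem prof_lt_level_of_le (hg : 2 ≤ g) {r : ℝ} (hr0 : 0 ≤ r) (hr : r ≤ 4 / 5) : prof g r < level g := by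
  have hV := V_le_half_sq hg hr0 (by linarith)
  have h1 := one_le_level (g := g)
  rw [prof_eq]
  nlinarith

/-- `1 ≤ κ ↔ prof ≤ c` (`r > 0`). [folklore] -/
theorem one_le_kap_iff (hg : 1 ≤ g) {r : ℝ} (hr : 0 < r) : 1 ≤ kap g r ↔ prof g r ≤ level g := by
  rw [kap, le_div_iff₀ (V_pos hg hr), prof_eq]
  constructor <;> intro h <;> linarith

/-- `κ ≤ 1 ↔ c ≤ prof` (`r > 0`). [folklore] -/
theorem kap_le_one_iff (hg : 1 ≤ g) {r : ℝ} (hr : 0 < r) : kap g r ≤ 1 ↔ level g ≤ prof g r := by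
  rw [kap, div_le_iff₀ (V_pos hg hr), prof_eq]
  constructor <;> intro h <;> linarith

/-- `0 ≤ κ ↔ r² ≤ c` (`r > 0`). [folklore] -/
theorem kap_nonneg_iff (hg : 1 ≤ g) {r : ℝ} (hr : 0 < r) : 0 ≤ kap g r ↔ r ^ 2 ≤ level g := by
  rw [kap, div_nonneg_iff]
  have hV := V_pos hg hr
  constructor
  · rintro (⟨h, -⟩ | ⟨-, h⟩)
    · linarith
    · linarith
  · intro h; exact Or.inl ⟨by linarith, hV.le⟩

/-- `-1 ≤ κ ↔ vprof ≤ c` (`r > 0`). [folklore] -/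
theorem neg_one_le_kap_iff (hg : 1 ≤ g) {r : ℝ} (hr : 0 < r) : -1 ≤ kap g r ↔ vprof g r ≤ level g := by
  rw [kap, le_div_iff₀ (V_pos hg hr), vprof]
  constructor <;> intro h <;> linarith

/-- `κ = -1 ↔ vprof = c` (`r > 0`). [folklore] -/
theorem kap_eq_neg_one_iff (hg : 1 ≤ g) {r : ℝ} (hr : 0 < r) : kap g r = -1 ↔ vprof g r = level g := by
  rw [kap, div_eq_iff (V_pos hg hr).ne', vprof]
  constructor <;> intro h <;> linarith

/-- The floor as a formula, for every `r > 0` (`g ≥ 2`). [folklore] -/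
theorem thlo_eq (hg : 2 ≤ g) {r : ℝ} (hr : 0 < r) : thlo g r = Real.arccos (min 1 (kap g r)) / g := by
  rw [thlo]
  split_ifs with h
  · have hk : 1 ≤ kap g r :=
      (one_le_kap_iff (by omega) hr).2 (prof_lt_level_of_le hg hr.le (by linarith)).le
    rw [min_eq_left hk, Real.arccos_one, zero_div]
  · rfl

/-- `θ_lo(0) = 0`. [folklore] -/
@[simp] theorem thlo_zero : thlo g 0 = 0 := by simp [thlo]

/-- `0 ≤ θ_lo`. [folklore] -/
theorem thlo_nonneg (r : ℝ) : 0 ≤ thlo g r := by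
  rw [thlo]; split_ifs
  · exact le_rfl
  · exact div_nonneg (Real.arccos_nonneg _) (Nat.cast_nonneg _)

/-- `θ_lo ≤ π/g` (`g ≥ 1`). [folklore] -/
theorem thlo_le (hg : 1 ≤ g) (r : ℝ) : thlo g r ≤ π / g := by
  have hg' : (0 : ℝ) < g := by exact_mod_cast (show 0 < g by omega)
  rw [thlo]; split_ifs
  · positivity
  · exact div_le_div_of_nonneg_right (Real.arccos_le_pi _) hg'.le

/-- **`θ_lo(r) = 0 ↔ prof(r) ≤ c`** (`r > 0`): the circle of radius `r` lies entirely in the flower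
domain iff the peak ray is inside at radius `r`. [folklore] -/
theorem thlo_eq_zero_iff (hg : 2 ≤ g) {r : ℝ} (hr : 0 < r) : thlo g r = 0 ↔ prof g r ≤ level g := by
  have hg' : (g : ℝ) ≠ 0 := by exact_mod_cast (show g ≠ 0 by omega)
  rw [thlo_eq hg hr, div_eq_zero_iff, or_iff_left hg', Real.arccos_eq_zero, le_min_iff,
    and_iff_right le_rfl, one_le_kap_iff (by omega) hr]

/-- `θ_lo(r) ≤ π/(2g)` when `r² ≤ c` (`r > 0`): the holes lie in the sectors `|θ - 2πj/g| < π/(2g)`.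
[folklore] -/
theorem thlo_le_half (hg : 2 ≤ g) {r : ℝ} (hr : 0 < r) (h : r ^ 2 ≤ level g) : thlo g r ≤ π / (2 * g) := by
  have hg' : (0 : ℝ) < g := by exact_mod_cast (show 0 < g by omega)
  have hk : 0 ≤ min 1 (kap g r) := le_min zero_le_one ((kap_nonneg_iff (by omega) hr).2 h)
  rw [thlo_eq hg hr, div_le_iff₀ hg']
  calc Real.arccos (min 1 (kap g r)) ≤ π / 2 := Real.arccos_le_pi_div_two.2 hk
    _ = π / (2 * g) * g := by field_simp

/-- `θ_lo(ρ₄) = π/g`: at the outer radius only the valley rays remain. [folklore] -/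
theorem thlo_rho4 (hg : 2 ≤ g) : thlo g (rho4 hg) = π / g := by
  have hk : kap g (rho4 hg) = -1 := (kap_eq_neg_one_iff (by omega) (rho4_pos hg)).2 (vprof_rho4 hg)
  rw [thlo_eq hg (rho4_pos hg), hk, min_eq_right (by norm_num), Real.arccos_neg_one]

/-- `cos y ≤ x ↔ arccos x ≤ y` for `x ∈ [-1, 1]`, `y ∈ [0, π]`. [folklore] -/
theorem cos_le_iff_arccos_le {x y : ℝ} (hx1 : -1 ≤ x) (hx2 : x ≤ 1) (hy0 : 0 ≤ y) (hyπ : y ≤ π) :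
    Real.cos y ≤ x ↔ Real.arccos x ≤ y := by
  constructor
  · intro h
    calc Real.arccos x ≤ Real.arccos (Real.cos y) := Real.antitone_arccos h
      _ = y := Real.arccos_cos hy0 hyπ
  · intro h
    calc Real.cos y ≤ Real.cos (Real.arccos x) :=
          Real.cos_le_cos_of_nonneg_of_le_pi (Real.arccos_nonneg _) hyπ h
      _ = x := Real.cos_arccos hx1 hx2

/-- `cos y = x ↔ x ≤ 1 ∧ -1 ≤ x ∧ y = arccos x` for `y ∈ [0, π]`. [folklore] -/
theorem cos_eq_iff_eq_arccos {x y : ℝ} (hy0 : 0 ≤ y) (hyπ : y ≤ π) :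
    Real.cos y = x ↔ -1 ≤ x ∧ x ≤ 1 ∧ y = Real.arccos x := by
  constructor
  · rintro rfl
    exact ⟨Real.neg_one_le_cos y, Real.cos_le_one y, (Real.arccos_cos hy0 hyπ).symm⟩
  · rintro ⟨h1, h2, rfl⟩
    exact Real.cos_arccos h1 h2

/-- **The floor criterion.**  For `0 < r ≤ ρ₄` and `0 ≤ θ ≤ π/g`:
`q(pol r θ) ≤ c ↔ θ_lo(r) ≤ θ`. [folklore] -/
theorem flower_pol_le_level_iff (hg : 2 ≤ g) {r θ : ℝ} (hr0 : 0 < r) (hr : r ≤ rho4 hg) (hθ0 : 0 ≤ θ)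
    (hθ : θ ≤ π / g) : flower g (pol r θ) ≤ level g ↔ thlo g r ≤ θ := by
  have hg1 : 1 ≤ g := by omega
  have hg' : (0 : ℝ) < g := by exact_mod_cast (show 0 < g by omega)
  have hV := V_pos hg1 hr0
  have hk : -1 ≤ kap g r := (neg_one_le_kap_iff hg1 hr0).2 ((vprof_le_level_iff hg hr0.le).2 hr)
  have hgθ0 : 0 ≤ g * θ := by positivity
  have hgθ : g * θ ≤ π := by rwa [le_div_iff₀ hg', mul_comm] at hθ
  rw [flower_pol, thlo_eq hg hr0, div_le_iff₀ hg', mul_comm θ]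
  rw [← cos_le_iff_arccos_le (le_min (by norm_num) hk) (min_le_left _ _) hgθ0 hgθ, le_min_iff,
    and_iff_right (Real.cos_le_one _), kap, le_div_iff₀ hV]
  constructor <;> intro h <;> linarith

/-- The floor criterion for negative angles (the flower is even in `θ`). [folklore] -/
theorem flower_pol_le_level_iff_abs (hg : 2 ≤ g) {r θ : ℝ} (hr0 : 0 < r) (hr : r ≤ rho4 hg)
    (hθ : |θ| ≤ π / g) : flower g (pol r θ) ≤ level g ↔ thlo g r ≤ |θ| := by
  rcases le_or_gt 0 θ with h | h
  · rw [abs_of_nonneg h] at hθ ⊢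
    exact flower_pol_le_level_iff hg hr0 hr h hθ
  · rw [abs_of_neg h] at hθ ⊢
    rw [← flower_pol_neg]
    exact flower_pol_le_level_iff hg hr0 hr (by linarith) hθ

/-- **The seam criterion.**  For `0 < r ≤ ρ₄` and `0 ≤ θ ≤ π/g`:
`q(pol r θ) = c ↔ c ≤ prof(r) ∧ θ = θ_lo(r)`. [folklore] -/
theorem flower_pol_eq_level_iff (hg : 2 ≤ g) {r θ : ℝ} (hr0 : 0 < r) (hr : r ≤ rho4 hg) (hθ0 : 0 ≤ θ)
    (hθ : θ ≤ π / g) : flower g (pol r θ) = level g ↔ level g ≤ prof g r ∧ θ = thlo g r := by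
  have hg1 : 1 ≤ g := by omega
  have hg' : (0 : ℝ) < g := by exact_mod_cast (show 0 < g by omega)
  have hgne : (g : ℝ) ≠ 0 := hg'.ne'
  have hV := V_pos hg1 hr0
  have hk : -1 ≤ kap g r := (neg_one_le_kap_iff hg1 hr0).2 ((vprof_le_level_iff hg hr0.le).2 hr)
  have hgθ0 : 0 ≤ g * θ := by positivity
  have hgθ : g * θ ≤ π := by rwa [le_div_iff₀ hg', mul_comm] at hθ
  have e1 : flower g (pol r θ) = level g ↔ Real.cos (g * θ) = kap g r := by
    rw [flower_pol, kap, eq_div_iff hV.ne']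
    constructor <;> intro h <;> linarith
  rw [e1, cos_eq_iff_eq_arccos hgθ0 hgθ, and_iff_right hk, kap_le_one_iff hg1 hr0, thlo_eq hg hr0]
  constructor
  · rintro ⟨h1, h2⟩
    refine ⟨h1, ?_⟩
    rw [min_eq_right ((kap_le_one_iff hg1 hr0).2 h1), ← h2]
    field_simp
  · rintro ⟨h1, h2⟩
    refine ⟨h1, ?_⟩
    rw [h2, min_eq_right ((kap_le_one_iff hg1 hr0).2 h1)]
    field_simp

/-- On the floor the point is a seam point iff `c ≤ prof(r)` (`0 < r ≤ ρ₄`). [folklore] -/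
theorem flower_pol_thlo_eq_level_iff (hg : 2 ≤ g) {r : ℝ} (hr0 : 0 < r) (hr : r ≤ rho4 hg) :
    flower g (pol r (thlo g r)) = level g ↔ level g ≤ prof g r := by
  rw [flower_pol_eq_level_iff hg hr0 hr (thlo_nonneg r) (thlo_le (by omega) r)]
  simp

/-- The floor point is always in the flower domain (`0 < r ≤ ρ₄`). [folklore] -/
theorem flower_pol_thlo_le (hg : 2 ≤ g) {r : ℝ} (hr0 : 0 < r) (hr : r ≤ rho4 hg) :
    flower g (pol r (thlo g r)) ≤ level g :=
  (flower_pol_le_level_iff hg hr0 hr (thlo_nonneg r) (thlo_le (by omega) r)).2 le_rfl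

/-- **The floor is continuous on `[0, ∞)`** (`g ≥ 2`). [folklore] -/
theorem continuousOn_thlo (hg : 2 ≤ g) : ContinuousOn (thlo g) (Ici 0) := by
  have hg1 : 1 ≤ g := by omega
  have hV : ContinuousOn (V g) univ := by
    unfold V damp; fun_prop
  have hF : ContinuousOn (fun r => Real.arccos (min 1 (kap g r)) / g) (Ioi 0) := by
    have hk : ContinuousOn (kap g) (Ioi 0) := by
      unfold kap
      refine ContinuousOn.div (by fun_prop) (hV.mono (subset_univ _)) fun r hr => (V_pos hg1 hr).ne'
    exact ((Real.continuous_arccos.comp_continuousOn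
      ((continuous_const.min continuous_id).comp_continuousOn hk)).div_const _)
  unfold thlo
  refine ContinuousOn.if ?_ continuousOn_const (hF.mono ?_)
  · rintro r ⟨-, hr⟩
    have hfr : r ∈ frontier (Iic (1 / 2 : ℝ)) := hr
    rw [frontier_Iic, mem_singleton_iff] at hfr
    subst hfr
    have hk : 1 ≤ kap g (1 / 2) :=
      (one_le_kap_iff hg1 (by norm_num)).2 (prof_lt_level_of_le hg (by norm_num) (by norm_num)).le
    rw [min_eq_left hk, Real.arccos_one, zero_div]
  · rintro r ⟨-, hr⟩
    have : r ∈ closure (Ioi (1 / 2 : ℝ)) := by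
      refine closure_mono (fun x hx => ?_) hr
      exact lt_of_not_ge hx
    rw [closure_Ioi] at this
    exact lt_of_lt_of_le (by norm_num : (0 : ℝ) < 1 / 2) (mem_Ici.1 this)

/-! ### §5 The half-wedge: the flower domain between the peak ray and the next valley ray -/

/-- The argument of a polar point: `arg (toC (pol r θ)) = θ` for `r > 0`, `θ ∈ (-π, π]`. [folklore] -/
theorem arg_toC_pol {r θ : ℝ} (hr : 0 < r) (hθ : θ ∈ Ioc (-π) π) : Complex.arg (toC (pol r θ)) = θ := by
  rw [toC_pol, Complex.arg_real_mul _ hr, Complex.arg_exp_mul_I, toIocMod_eq_self]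
  exact ⟨by linarith [hθ.1], by linarith [hθ.2]⟩

/-- **The half-wedge in the parameter plane**: `0 ≤ r ≤ ρ₄`, `θ_lo(r) ≤ θ ≤ π/g`. [folklore] -/
def halfWedgeParam (hg : 2 ≤ g) : Set (ℝ × ℝ) :=
  {x | 0 ≤ x.1 ∧ x.1 ≤ rho4 hg ∧ thlo g x.1 ≤ x.2 ∧ x.2 ≤ π / g}

/-- **The half-wedge of the flower domain**: the points of `{q ≤ c}` with argument in `[0, π/g]`.
[folklore] -/
def halfWedge (g : ℕ) : Set (𝔼 2) :=
  {p | flower g p ≤ level g ∧ 0 ≤ Complex.arg (toC p) ∧ Complex.arg (toC p) ≤ π / g}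

/-- **Polar parametrization of the half-wedge**: `halfWedge = pol(halfWedgeParam)`. [folklore] -/
theorem halfWedge_eq_image (hg : 2 ≤ g) :
    halfWedge g = (fun x : ℝ × ℝ => pol x.1 x.2) '' halfWedgeParam hg := by
  have hg1 : 1 ≤ g := by omega
  have hg' : (0 : ℝ) < g := by exact_mod_cast (show 0 < g by omega)
  have hπg : π / g ≤ π := div_le_self Real.pi_pos.le (by exact_mod_cast hg1)
  ext p
  constructor
  · rintro ⟨hq, h0, h1⟩
    by_cases hp0 : p = 0
    · refine ⟨(0, 0), ⟨le_rfl, (rho4_pos hg).le, by simp, by positivity⟩, ?_⟩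
      simp [hp0]
    · have hr : 0 < ‖p‖ := norm_pos_iff.2 hp0
      obtain ⟨θ, hθ, hp⟩ := exists_eq_pol p
      have harg : Complex.arg (toC p) = θ := by rw [hp]; exact arg_toC_pol hr hθ
      rw [harg] at h0 h1
      have hρ : ‖p‖ ≤ rho4 hg := norm_le_rho4_of_flower_le hg hq
      rw [hp] at hq
      refine ⟨(‖p‖, θ), ⟨norm_nonneg p, hρ, ?_, h1⟩, hp.symm⟩
      exact (flower_pol_le_level_iff hg hr hρ h0 h1).1 hq
  · rintro ⟨⟨r, θ⟩, ⟨hr0, hr, hlo, hhi⟩, rfl⟩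
    simp only
    have hθ0 : 0 ≤ θ := le_trans (thlo_nonneg r) hlo
    rcases hr0.eq_or_lt with h | h
    · subst h
      refine ⟨?_, ?_, ?_⟩
      · rw [pol_zero_left, flower_zero hg1]; exact (level_pos hg1).le
      · simp
      · simp; positivity
    · have harg : Complex.arg (toC (pol r θ)) = θ :=
        arg_toC_pol h ⟨by linarith [Real.pi_pos], le_trans hhi hπg⟩
      refine ⟨(flower_pol_le_level_iff hg h hr hθ0 hhi).2 hlo, ?_, ?_⟩
      · rw [harg]; exact hθ0
      · rw [harg]; exact hhi

/-- The parameter set of the half-wedge is closed. [folklore] -/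
theorem isClosed_halfWedgeParam (hg : 2 ≤ g) : IsClosed (halfWedgeParam hg) := by
  have hcont : ContinuousOn (fun x : ℝ × ℝ => thlo g x.1 - x.2) (Ici (0 : ℝ) ×ˢ univ) :=
    ((continuousOn_thlo hg).comp continuous_fst.continuousOn fun x hx => hx.1).sub
      continuous_snd.continuousOn
  have h1 : IsClosed ((Ici (0 : ℝ) ×ˢ (univ : Set ℝ)) ∩ (fun x : ℝ × ℝ => thlo g x.1 - x.2) ⁻¹' Iic 0) :=
    hcont.preimage_isClosed_of_isClosed (isClosed_Ici.prod isClosed_univ) isClosed_Iic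
  have h2 : IsClosed ((fun x : ℝ × ℝ => x.1) ⁻¹' Iic (rho4 hg)) := isClosed_Iic.preimage continuous_fst
  have h3 : IsClosed ((fun x : ℝ × ℝ => x.2) ⁻¹' Iic (π / g)) := isClosed_Iic.preimage continuous_snd
  have heq : halfWedgeParam hg = ((Ici (0 : ℝ) ×ˢ (univ : Set ℝ)) ∩
      (fun x : ℝ × ℝ => thlo g x.1 - x.2) ⁻¹' Iic 0) ∩ (fun x : ℝ × ℝ => x.1) ⁻¹' Iic (rho4 hg) ∩
        (fun x : ℝ × ℝ => x.2) ⁻¹' Iic (π / g) := by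
    ext ⟨r, θ⟩
    simp only [halfWedgeParam, mem_setOf_eq, mem_inter_iff, mem_prod, mem_Ici, mem_univ, and_true,
      mem_preimage, mem_Iic, sub_nonpos]
    tauto
  rw [heq]
  exact (h1.inter h2).inter h3

/-- The parameter set lies in the rectangle `[0, ρ₄] × [0, π/g]`. [folklore] -/
theorem halfWedgeParam_subset (hg : 2 ≤ g) :
    halfWedgeParam hg ⊆ Icc (0 : ℝ) (rho4 hg) ×ˢ Icc (0 : ℝ) (π / g) := by
  rintro ⟨r, θ⟩ ⟨hr0, hr, hlo, hhi⟩
  exact ⟨⟨hr0, hr⟩, ⟨le_trans (thlo_nonneg r) hlo, hhi⟩⟩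

/-- The parameter set of the half-wedge is compact. [folklore] -/
theorem isCompact_halfWedgeParam (hg : 2 ≤ g) : IsCompact (halfWedgeParam hg) :=
  (isCompact_Icc.prod isCompact_Icc).of_isClosed_subset (isClosed_halfWedgeParam hg)
    (halfWedgeParam_subset hg)

/-- The half-wedge is compact. [folklore] -/
theorem isCompact_halfWedge (hg : 2 ≤ g) : IsCompact (halfWedge g) := by
  rw [halfWedge_eq_image hg]
  exact (isCompact_halfWedgeParam hg).image continuous_pol


/-! ### §6 Where the peak ray lies in the flower domain: the radii `ρ₁ < r_a < 7^{1/20g} < r_b < ρ₃` -/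

/-- `φ < 2` on `(0, r_a)`. [folklore] -/
theorem φ_lt_two_of_lt_ra (hg : 2 ≤ g) {r : ℝ} (hr0 : 0 < r) (hr : r < ra hg) : φ g r < 2 := by
  rcases le_or_gt r 1 with h1 | h1
  · exact lt_of_le_of_lt (φ_nonpos hr0.le h1) two_pos
  · have hmono := strictMonoOn_φ hg (R := ra hg) (by linarith [ra_pow_lt hg])
    have := hmono ⟨h1.le, hr.le⟩ ⟨(one_lt_ra hg).le, le_rfl⟩ hr
    rwa [φ_ra hg] at this

/-- `φ < 2` on `(r_b, ∞)`. [folklore] -/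
theorem φ_lt_two_of_rb_lt (hg : 2 ≤ g) {r : ℝ} (hr : rb hg < r) : φ g r < 2 := by
  have hanti := strictAntiOn_φ hg (R := rb hg) (rb_pos hg) (lt_rb_pow hg).le
  have := hanti (Set.mem_Ici.2 (le_refl (rb hg))) (Set.mem_Ici.2 hr.le) hr
  rwa [φ_rb hg] at this

/-- `f' > 0` on `(0, r_a)`. [folklore] -/
theorem fd_pos_of_lt_ra (hg : 2 ≤ g) {r : ℝ} (hr0 : 0 < r) (hr : r < ra hg) : 0 < fd g r := by
  rw [fd_eq hg]; exact mul_pos hr0 (by linarith [φ_lt_two_of_lt_ra hg hr0 hr])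

/-- `f' > 0` on `(r_b, ∞)`. [folklore] -/
theorem fd_pos_of_rb_lt (hg : 2 ≤ g) {r : ℝ} (hr : rb hg < r) : 0 < fd g r := by
  rw [fd_eq hg]; exact mul_pos (lt_trans (rb_pos hg) hr) (by linarith [φ_lt_two_of_rb_lt hg hr])

/-- **The peak profile is strictly increasing on `[0, r_a]`.** [folklore] -/
theorem strictMonoOn_prof_left (hg : 2 ≤ g) : StrictMonoOn (prof g) (Icc 0 (ra hg)) := by
  have hg1 : 1 ≤ g := by omega
  refine strictMonoOn_of_deriv_pos (convex_Icc _ _) (continuous_prof hg1).continuousOn fun x hx => ?_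
  rw [interior_Icc] at hx
  rw [(hasDerivAt_prof hg1 x).deriv]
  exact fd_pos_of_lt_ra hg hx.1 hx.2

/-- **The peak profile is strictly increasing on `[r_b, ∞)`.** [folklore] -/
theorem strictMonoOn_prof_right (hg : 2 ≤ g) : StrictMonoOn (prof g) (Ici (rb hg)) := by
  have hg1 : 1 ≤ g := by omega
  refine strictMonoOn_of_deriv_pos (convex_Ici _) (continuous_prof hg1).continuousOn fun x hx => ?_
  rw [interior_Ici] at hx
  rw [(hasDerivAt_prof hg1 x).deriv]
  exact fd_pos_of_rb_lt hg hx

/-- `prof 0 = 0` (`g ≥ 1`). [folklore] -/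
theorem prof_zero (hg : 1 ≤ g) : prof g 0 = 0 := by
  simp [prof, zero_pow (show g ≠ 0 by omega)]

/-- `4/5 < r_a`. [folklore] -/
theorem four_fifths_lt_ra (hg : 2 ≤ g) : (4 : ℝ) / 5 < ra hg := lt_trans (by norm_num) (one_lt_ra hg)

/-- There is `ρ₁ ∈ (4/5, r_a)` with `prof ρ₁ = c`. [folklore] -/
theorem exists_rho1 (hg : 2 ≤ g) : ∃ r, r ∈ Ioo ((4 : ℝ) / 5) (ra hg) ∧ prof g r = level g := by
  have hg1 : 1 ≤ g := by omega
  have h := intermediate_value_Ioo (four_fifths_lt_ra hg).le (continuous_prof hg1).continuousOn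
    (f := prof g)
  have hmem : level g ∈ Ioo (prof g (4 / 5)) (prof g (ra hg)) :=
    ⟨prof_lt_level_of_le hg (by norm_num) le_rfl, level_lt_prof_ra hg⟩
  obtain ⟨r, hr, hr2⟩ := h hmem
  exact ⟨r, hr, hr2⟩

/-- **The inner pinch radius `ρ₁`**: the peak ray leaves the flower domain at `r = ρ₁` (and
re-enters at `7^{1/20g}`). [folklore] -/
def rho1 (hg : 2 ≤ g) : ℝ := Classical.choose (exists_rho1 hg)

/-- `ρ₁ ∈ (4/5, r_a)`. [folklore] -/
theorem rho1_mem (hg : 2 ≤ g) : rho1 hg ∈ Ioo ((4 : ℝ) / 5) (ra hg) := (Classical.choose_spec (exists_rho1 hg)).1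

/-- `prof ρ₁ = c`. [folklore] -/
theorem prof_rho1 (hg : 2 ≤ g) : prof g (rho1 hg) = level g := (Classical.choose_spec (exists_rho1 hg)).2

/-- `ρ₁ > 0`. [folklore] -/
theorem rho1_pos (hg : 2 ≤ g) : 0 < rho1 hg := lt_trans (by norm_num) (rho1_mem hg).1

/-- `ρ₁ < 7^{1/20g}`. [folklore] -/
theorem rho1_lt_rt_seven (hg : 2 ≤ g) : rho1 hg < rt g 7 := lt_trans (rho1_mem hg).2 (ra_lt_rt_seven hg)

/-- `prof 6 > c`. [folklore] -/
theorem level_lt_prof_six (hg : 2 ≤ g) : level g < prof g 6 := by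
  rw [prof_eq]
  nlinarith [level_lt hg, V_nonneg (g := g) (by norm_num : (0:ℝ) ≤ 6)]

/-- `r_b < 6`. [folklore] -/
theorem rb_lt_six (hg : 2 ≤ g) : rb hg < 6 := by
  have hg1 : 1 ≤ g := by omega
  have h1 : rb hg < rt g 400 := (rb_mem hg).2
  have h2 : rt g 400 ≤ 6 := by
    rw [← le_pow_iff_rt_le hg1 (by norm_num) (by norm_num)]
    calc (400 : ℝ) ≤ 6 ^ 4 := by norm_num
      _ ≤ 6 ^ (20 * g) := pow_le_pow_right₀ (by norm_num) (by omega)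
  linarith


/-- There is `ρ₃ ∈ (r_b, 6)` with `prof ρ₃ = c`. [folklore] -/
theorem exists_rho3 (hg : 2 ≤ g) : ∃ r, r ∈ Ioo (rb hg) 6 ∧ prof g r = level g := by
  have hg1 : 1 ≤ g := by omega
  have h := intermediate_value_Ioo (rb_lt_six hg).le (continuous_prof hg1).continuousOn (f := prof g)
  have hmem : level g ∈ Ioo (prof g (rb hg)) (prof g 6) := ⟨prof_rb_lt_level hg, level_lt_prof_six hg⟩
  obtain ⟨r, hr, hr2⟩ := h hmem
  exact ⟨r, hr, hr2⟩

/-- **The outer indentation radius `ρ₃`**: the peak ray leaves the flower domain for good at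
`r = ρ₃`. [folklore] -/
def rho3 (hg : 2 ≤ g) : ℝ := Classical.choose (exists_rho3 hg)

/-- `ρ₃ ∈ (r_b, 6)`. [folklore] -/
theorem rho3_mem (hg : 2 ≤ g) : rho3 hg ∈ Ioo (rb hg) 6 := (Classical.choose_spec (exists_rho3 hg)).1

/-- `prof ρ₃ = c`. [folklore] -/
theorem prof_rho3 (hg : 2 ≤ g) : prof g (rho3 hg) = level g := (Classical.choose_spec (exists_rho3 hg)).2

/-- `7^{1/20g} < ρ₃`. [folklore] -/
theorem rt_seven_lt_rho3 (hg : 2 ≤ g) : rt g 7 < rho3 hg := lt_trans (rt_seven_lt_rb hg) (rho3_mem hg).1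

/-- `ρ₃ > 0`. [folklore] -/
theorem rho3_pos (hg : 2 ≤ g) : 0 < rho3 hg := lt_trans (rb_pos hg) (rho3_mem hg).1

/-- `ρ₃ < ρ₄`: the indentations lie inside the outer circle. [folklore] -/
theorem rho3_lt_rho4 (hg : 2 ≤ g) : rho3 hg < rho4 hg := by
  have hg1 : 1 ≤ g := by omega
  have hlt : vprof g (rho3 hg) < level g := by
    rw [← prof_rho3 hg, vprof, prof_eq]
    linarith [V_pos hg1 (rho3_pos hg)]
  by_contra hle
  push Not at hle
  have := (strictMonoOn_vprof hg).le_iff_le (rho4_pos hg).le (rho3_pos hg).le |>.2 hle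
  rw [vprof_rho4 hg] at this
  linarith

/-- On `[0, r_a]`: `prof r ≤ c ↔ r ≤ ρ₁`. [folklore] -/
theorem prof_le_level_iff_left (hg : 2 ≤ g) {r : ℝ} (hr0 : 0 ≤ r) (hr : r ≤ ra hg) :
    prof g r ≤ level g ↔ r ≤ rho1 hg := by
  rw [← prof_rho1 hg]
  exact (strictMonoOn_prof_left hg).le_iff_le ⟨hr0, hr⟩ ⟨(rho1_pos hg).le, (rho1_mem hg).2.le⟩

/-- On `[r_a, r_b]`: `prof r ≤ c ↔ 7^{1/20g} ≤ r`. [folklore] -/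
theorem prof_le_level_iff_mid (hg : 2 ≤ g) {r : ℝ} (hr1 : ra hg ≤ r) (hr2 : r ≤ rb hg) :
    prof g r ≤ level g ↔ rt g 7 ≤ r := by
  rw [show level g = prof g (rt g 7) from rfl]
  exact (strictAntiOn_prof hg).le_iff_ge ⟨hr1, hr2⟩ ⟨(ra_lt_rt_seven hg).le, (rt_seven_lt_rb hg).le⟩

/-- On `[r_b, ∞)`: `prof r ≤ c ↔ r ≤ ρ₃`. [folklore] -/
theorem prof_le_level_iff_right (hg : 2 ≤ g) {r : ℝ} (hr : rb hg ≤ r) :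
    prof g r ≤ level g ↔ r ≤ rho3 hg := by
  rw [← prof_rho3 hg]
  exact (strictMonoOn_prof_right hg).le_iff_le hr (rho3_mem hg).1.le

/-- **Where the peak ray lies in the flower domain**: for `r ≥ 0`,
`prof r ≤ c ↔ r ≤ ρ₁ ∨ 7^{1/20g} ≤ r ≤ ρ₃`. [folklore] -/
theorem prof_le_level_iff (hg : 2 ≤ g) {r : ℝ} (hr0 : 0 ≤ r) :
    prof g r ≤ level g ↔ r ≤ rho1 hg ∨ (rt g 7 ≤ r ∧ r ≤ rho3 hg) := by
  have h1 := (rho1_mem hg).2      -- ρ₁ < r_a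
  have h2 := ra_lt_rt_seven hg
  have h3 := rt_seven_lt_rb hg
  have h4 := (rho3_mem hg).1      -- r_b < ρ₃
  rcases le_or_gt r (ra hg) with hra | hra
  · rw [prof_le_level_iff_left hg hr0 hra]
    constructor
    · exact Or.inl
    · rintro (h | ⟨h, -⟩)
      · exact h
      · linarith
  rcases le_or_gt r (rb hg) with hrb | hrb
  · rw [prof_le_level_iff_mid hg hra.le hrb]
    constructor
    · intro h; exact Or.inr ⟨h, by linarith⟩
    · rintro (h | ⟨h, -⟩)
      · linarith
      · exact h
  · rw [prof_le_level_iff_right hg hrb.le]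
    constructor
    · intro h; exact Or.inr ⟨by linarith, h⟩
    · rintro (h | ⟨-, h⟩)
      · linarith
      · exact h

/-- **Where the peak ray is outside (or on the boundary)**: for `0 ≤ r ≤ ρ₄`,
`c ≤ prof r ↔ ρ₁ ≤ r ≤ 7^{1/20g} ∨ ρ₃ ≤ r`. [folklore] -/
theorem level_le_prof_iff (hg : 2 ≤ g) {r : ℝ} (hr0 : 0 ≤ r) :
    level g ≤ prof g r ↔ (rho1 hg ≤ r ∧ r ≤ rt g 7) ∨ rho3 hg ≤ r := by
  have h1 := (rho1_mem hg).2
  have h2 := ra_lt_rt_seven hg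
  have h3 := rt_seven_lt_rb hg
  have h4 := (rho3_mem hg).1
  rcases le_or_gt r (ra hg) with hra | hra
  · rw [← prof_rho1 hg, (strictMonoOn_prof_left hg).le_iff_le ⟨(rho1_pos hg).le, h1.le⟩ ⟨hr0, hra⟩]
    constructor
    · intro h; exact Or.inl ⟨h, by linarith⟩
    · rintro (⟨h, -⟩ | h)
      · exact h
      · linarith
  rcases le_or_gt r (rb hg) with hrb | hrb
  · rw [show level g = prof g (rt g 7) from rfl,
      (strictAntiOn_prof hg).le_iff_ge ⟨h2.le, h3.le⟩ ⟨hra.le, hrb⟩]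
    constructor
    · intro h; exact Or.inl ⟨by linarith, h⟩
    · rintro (⟨-, h⟩ | h)
      · exact h
      · linarith
  · rw [← prof_rho3 hg, (strictMonoOn_prof_right hg).le_iff_le h4.le hrb.le]
    constructor
    · intro h; exact Or.inr h
    · rintro (⟨-, h⟩ | h)
      · linarith
      · exact h

/-- `θ_lo = 0` exactly on `[0, ρ₁] ∪ [7^{1/20g}, ρ₃]` (for `0 < r`). [folklore] -/
theorem thlo_eq_zero_iff' (hg : 2 ≤ g) {r : ℝ} (hr : 0 < r) :
    thlo g r = 0 ↔ r ≤ rho1 hg ∨ (rt g 7 ≤ r ∧ r ≤ rho3 hg) := by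
  rw [thlo_eq_zero_iff hg hr, prof_le_level_iff hg hr.le]

/-- The floor vanishes on `[0, ρ₁]`: the disc of radius `ρ₁` lies in the flower domain. [folklore] -/
theorem thlo_eq_zero_of_le_rho1 (hg : 2 ≤ g) {r : ℝ} (hr0 : 0 ≤ r) (hr : r ≤ rho1 hg) : thlo g r = 0 := by
  rcases hr0.eq_or_lt with h | h
  · rw [← h]; exact thlo_zero
  · exact (thlo_eq_zero_iff' hg h).2 (Or.inl hr)

/-- The floor vanishes on `[7^{1/20g}, ρ₃]`: the segment `m` of the peak ray beyond the lens tip lies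
in the flower domain. [folklore] -/
theorem thlo_eq_zero_of_mem (hg : 2 ≤ g) {r : ℝ} (hr1 : rt g 7 ≤ r) (hr : r ≤ rho3 hg) : thlo g r = 0 :=
  (thlo_eq_zero_iff' hg (lt_of_lt_of_le (rt_pos (by norm_num)) hr1)).2 (Or.inr ⟨hr1, hr⟩)

/-- The floor is positive on the lens range `(ρ₁, 7^{1/20g})`. [folklore] -/
theorem thlo_pos_of_mem_lens (hg : 2 ≤ g) {r : ℝ} (hr1 : rho1 hg < r) (hr : r < rt g 7) : 0 < thlo g r := by
  have hr0 : 0 < r := lt_trans (rho1_pos hg) hr1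
  refine lt_of_le_of_ne (thlo_nonneg r) fun h => ?_
  rcases (thlo_eq_zero_iff' hg hr0).1 h.symm with h' | ⟨h', -⟩
  · linarith
  · linarith

/-- The floor is positive on the petal range `(ρ₃, ρ₄]`. [folklore] -/
theorem thlo_pos_of_rho3_lt (hg : 2 ≤ g) {r : ℝ} (hr : rho3 hg < r) : 0 < thlo g r := by
  have hr0 : 0 < r := lt_trans (rho3_pos hg) hr
  refine lt_of_le_of_ne (thlo_nonneg r) fun h => ?_
  rcases (thlo_eq_zero_iff' hg hr0).1 h.symm with h' | ⟨-, h'⟩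
  · linarith [(rho1_mem hg).2, ra_lt_rt_seven hg, rt_seven_lt_rho3 hg]
  · linarith

end FlowerModel

end Literature.Topology.FourManifolds
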